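import Mathlib
import Summits.Ventures.PercRepro2.CrossWeightedBHK
import Summits.Ventures.PercRepro2.OtherClusterAvoid

/-!
# The status-level (FM) is a positive bilinear form in the BHK slacks of two marks relative to a vertex
(blind cell PercRepro2, night-1 g29; proofs/NIGHT1-G29.md §5.4)

Under `Q = {a₁ ↮ a₂}` let `v` be any vertex and `b, o` two marks; `s_v ∈ {L, H, N}` is the status of `v`
(`v ∈ C₁`, `v ∈ C₂`, `v ∉ C₁ ∪ C₂`) with law `(a, c, r)`, `r = 1 − a − c`. For a mark `x` write
`L_x^s = P(x ∈ C₁ ∣ s_v = s)`, `H_x^s = P(x ∈ C₂ ∣ s_v = s)` and the FOUR BHK SLACKS of `x` relative to `v`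
`x₁ = L_x^L − L_x^N`, `x₂ = L_x^N − L_x^H`, `y₁ = H_x^N − H_x^L`, `y₂ = H_x^H − H_x^N` (all `≥ 0`:
`x₂, y₁` by `CrossWeighted.cond_cross_avoid` (N), `x₁, y₂` by `OtherClusterAvoid.condH_chain` — the two
chains `P(x∈C₂ ∣ v∈C₁) ≤ P(x∈C₂ ∣ v∉U) ≤ P(x∈C₂ ∣ v∈C₂)`, `P(x∈C₁ ∣ v∈C₂) ≤ P(x∈C₁ ∣ v∉U) ≤ P(x∈C₁ ∣ v∈C₁)`).

**(FM-coarse)** is the status-level form of the first-order residual (MEANS-a₃) at a pendant `a₃` at `v`: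
`Cov_{s_v}(E[σ_b ∣ s_v], E[F^{(v)} ∣ s_v]) − r·(E[U_b ∣ N] − ⟨U_b⟩)(E[U_o ∣ N] − ⟨U_o⟩)` with
`F^{(v)} = σ_o − σ_v (U_o − ⟨U_o⟩)`, i.e. `E[F ∣ L] = ⟨U_o⟩ − 2H_o^L`, `E[F ∣ H] = 2L_o^H − ⟨U_o⟩`,
`E[F ∣ N] = L_o^N − H_o^N` (`fmCoarse`). THE IDENTITY (`fmCoarse_eq`, `ring`): it equals the bilinear form
`∑ c_{ij}(a, c) · (slack_i of b)(slack_j of o)` with the sixteen coefficients of `bilin` — every one `≥ 0` on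
the simplex — and no other term; hence **`fmCoarse_nonneg`**: (FM-coarse) `≥ 0` whenever the eight slacks are.
At `v = b` it is (FM-b) (`CrossWeightedBHK`), at `v = o` BHK 1.4. The percolation instance
(`fmCoarse_nonneg_of_chains`) takes the eight slack inequalities as hypotheses, each an instance of the
two chain theorems named above; **`fmCoarse_nonneg_perc`** discharges them (the `Q`-mass forms of the four
(N)-links are `cond_cross_avoid` in the two root orientations, the four same-cluster links are
`condH_chain` read through `{C(a₁) ∩ {a₂, v} = ∅} = Q ∩ {v ∉ C₁} = (Q ∩ {v ∈ C₂}) ⊔ (Q ∩ {v ∉ U})`), leaving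
only the positivity of the three status masses of `v`. Standard axioms.
-/

namespace Summit.Ventures.PercRepro2

namespace FMCoarse

section Algebra

variable {R : Type*} [Field R] [LinearOrder R] [IsStrictOrderedRing R]

/-- The status-level (FM): `a, c` the masses of `v ∈ C₁`, `v ∈ C₂` (so `1 − a − c` of `v ∉ U`),
`LbL … HoN` the twelve conditional probabilities `L_x^s, H_x^s`. -/
def fmCoarse (a c LbL LbH LbN HbL HbH HbN LoL LoH LoN HoL HoH HoN : R) : R :=
  let r := 1 - a - c
  let u := a * (LoL + HoL) + c * (LoH + HoH) + r * (LoN + HoN)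
  let ub := a * (LbL + HbL) + c * (LbH + HbH) + r * (LbN + HbN)
  let DL := LbL - HbL
  let DH := LbH - HbH
  let DN := LbN - HbN
  let FL := u - 2 * HoL
  let FH := 2 * LoH - u
  let FN := LoN - HoN
  let mD := a * DL + c * DH + r * DN
  let mF := a * FL + c * FH + r * FN
  a * (DL - mD) * (FL - mF) + c * (DH - mD) * (FH - mF) + r * (DN - mD) * (FN - mF) -
    r * ((LbN + HbN) - ub) * ((LoN + HoN) - u)

/-- The bilinear form in the slacks `x₁ x₂ y₁ y₂` (of `b`) and `X₁ X₂ Y₁ Y₂` (of `o`). -/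
def bilin (a c x₁ x₂ y₁ y₂ X₁ X₂ Y₁ Y₂ : R) : R :=
  2 * a * a * c * x₁ * X₁ + 2 * a * c * (1 - c) * x₁ * X₂ + 2 * a * (1 - a - a * c) * x₁ * Y₁ +
      2 * a * c * c * x₁ * Y₂ +
    2 * a * c * (1 - c) * x₂ * X₁ + 2 * c * (1 - c) * (1 - c) * x₂ * X₂ + 2 * a * c * c * x₂ * Y₁ +
      2 * c * c * (1 - c) * x₂ * Y₂ +
    2 * a * a * (1 - a) * y₁ * X₁ + 2 * a * a * c * y₁ * X₂ + 2 * a * (1 - a) * (1 - a) * y₁ * Y₁ +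
      2 * a * c * (1 - a) * y₁ * Y₂ +
    2 * a * a * c * y₂ * X₁ + 2 * c * (1 - c - a * c) * y₂ * X₂ + 2 * a * c * (1 - a) * y₂ * Y₁ +
      2 * a * c * c * y₂ * Y₂

omit [LinearOrder R] [IsStrictOrderedRing R] in
/-- **The identity**: (FM-coarse) is the bilinear form in the slacks — no base-level term survives. -/
theorem fmCoarse_eq (a c LbL LbH LbN HbL HbH HbN LoL LoH LoN HoL HoH HoN : R) :
    fmCoarse a c LbL LbH LbN HbL HbH HbN LoL LoH LoN HoL HoH HoN =
      bilin a c (LbL - LbN) (LbN - LbH) (HbN - HbL) (HbH - HbN)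
        (LoL - LoN) (LoN - LoH) (HoN - HoL) (HoH - HoN) := by
  unfold fmCoarse bilin
  ring

/-- The sixteen coefficients are nonnegative on the simplex and the slacks are nonnegative, so the
bilinear form is. -/
theorem bilin_nonneg {a c x₁ x₂ y₁ y₂ X₁ X₂ Y₁ Y₂ : R} (ha : 0 ≤ a) (hc : 0 ≤ c) (hac : a + c ≤ 1)
    (hx₁ : 0 ≤ x₁) (hx₂ : 0 ≤ x₂) (hy₁ : 0 ≤ y₁) (hy₂ : 0 ≤ y₂)
    (hX₁ : 0 ≤ X₁) (hX₂ : 0 ≤ X₂) (hY₁ : 0 ≤ Y₁) (hY₂ : 0 ≤ Y₂) :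
    0 ≤ bilin a c x₁ x₂ y₁ y₂ X₁ X₂ Y₁ Y₂ := by
  unfold bilin
  have h1a : 0 ≤ 1 - a := by linarith
  have h1c : 0 ≤ 1 - c := by linarith
  have hac' : 0 ≤ 1 - a - a * c := by nlinarith
  have hca' : 0 ≤ 1 - c - a * c := by nlinarith
  have t1 : 0 ≤ 2 * a * a * c * x₁ * X₁ := by positivity
  have t2 : 0 ≤ 2 * a * c * (1 - c) * x₁ * X₂ := by positivity
  have t3 : 0 ≤ 2 * a * (1 - a - a * c) * x₁ * Y₁ := by positivity
  have t4 : 0 ≤ 2 * a * c * c * x₁ * Y₂ := by positivity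
  have t5 : 0 ≤ 2 * a * c * (1 - c) * x₂ * X₁ := by positivity
  have t6 : 0 ≤ 2 * c * (1 - c) * (1 - c) * x₂ * X₂ := by positivity
  have t7 : 0 ≤ 2 * a * c * c * x₂ * Y₁ := by positivity
  have t8 : 0 ≤ 2 * c * c * (1 - c) * x₂ * Y₂ := by positivity
  have t9 : 0 ≤ 2 * a * a * (1 - a) * y₁ * X₁ := by positivity
  have t10 : 0 ≤ 2 * a * a * c * y₁ * X₂ := by positivity
  have t11 : 0 ≤ 2 * a * (1 - a) * (1 - a) * y₁ * Y₁ := by positivity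
  have t12 : 0 ≤ 2 * a * c * (1 - a) * y₁ * Y₂ := by positivity
  have t13 : 0 ≤ 2 * a * a * c * y₂ * X₁ := by positivity
  have t14 : 0 ≤ 2 * c * (1 - c - a * c) * y₂ * X₂ := by positivity
  have t15 : 0 ≤ 2 * a * c * (1 - a) * y₂ * Y₁ := by positivity
  have t16 : 0 ≤ 2 * a * c * c * y₂ * Y₂ := by positivity
  linarith

/-- **(FM-coarse) ≥ 0** whenever the eight BHK slacks of `b` and `o` relative to `v` are nonnegative. -/
theorem fmCoarse_nonneg {a c LbL LbH LbN HbL HbH HbN LoL LoH LoN HoL HoH HoN : R}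
    (ha : 0 ≤ a) (hc : 0 ≤ c) (hac : a + c ≤ 1)
    (hb₁ : LbN ≤ LbL) (hb₂ : LbH ≤ LbN) (hb₃ : HbL ≤ HbN) (hb₄ : HbN ≤ HbH)
    (ho₁ : LoN ≤ LoL) (ho₂ : LoH ≤ LoN) (ho₃ : HoL ≤ HoN) (ho₄ : HoN ≤ HoH) :
    0 ≤ fmCoarse a c LbL LbH LbN HbL HbH HbN LoL LoH LoN HoL HoH HoN := by
  rw [fmCoarse_eq]
  exact bilin_nonneg ha hc hac (by linarith) (by linarith) (by linarith) (by linarith)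
    (by linarith) (by linarith) (by linarith) (by linarith)

end Algebra

section Percolation

open UnionCluster

variable {V : Type*} {E : Type*} [Fintype E] [DecidableEq E] [Fintype V] [DecidableEq V]
  {R : Type*} [Field R] [LinearOrder R] [IsStrictOrderedRing R]

/-- The conditional probability `P(Q ∩ S ∩ X) / P(Q ∩ S)` of `X` given the status event `S` of `v`. -/
noncomputable def condP (p : E → R) (Q S X : Set (Config E)) : R :=
  prob p (Q ∩ S ∩ X) / prob p (Q ∩ S)

/-- A cleared chain inequality `P(Q, S, X) · P(Q, S') ≤ P(Q, S', X) · P(Q, S)` with `P(Q, S), P(Q, S') > 0`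
gives `condP S X ≤ condP S' X`. -/
lemma condP_le_of_cleared (p : E → R) {Q S S' X : Set (Config E)} (hS : 0 < prob p (Q ∩ S))
    (hS' : 0 < prob p (Q ∩ S'))
    (h : prob p (Q ∩ S ∩ X) * prob p (Q ∩ S') ≤ prob p (Q ∩ S' ∩ X) * prob p (Q ∩ S)) :
    condP p Q S X ≤ condP p Q S' X := by
  unfold condP
  rw [div_le_div_iff₀ hS hS']
  exact h

omit [Fintype V] [DecidableEq V] in
/-- **(FM-coarse) for percolation, under the chain inequalities** (the caller supplies the eight cleared
chain inequalities — instances of `CrossWeighted.cond_cross_avoid` and `OtherClusterAvoid.condH_chain` —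
and the positivity of the three status masses of `v`). -/
theorem fmCoarse_nonneg_of_chains (p : E → R) (hp : IsProbVec p) (ends : E → Sym2 V) (o a₁ a₂ b v : V)
    (hL : 0 < prob p (avoidAll ends a₂ {a₁} ∩ connEvent ends a₁ v))
    (hH : 0 < prob p (avoidAll ends a₂ {a₁} ∩ connEvent ends a₂ v))
    (hN : 0 < prob p (avoidAll ends a₂ {a₁} ∩ ((connEvent ends a₁ v)ᶜ ∩ (connEvent ends a₂ v)ᶜ)))
    (hb₁ : prob p (avoidAll ends a₂ {a₁} ∩ ((connEvent ends a₁ v)ᶜ ∩ (connEvent ends a₂ v)ᶜ) ∩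
        connEvent ends a₁ b) * prob p (avoidAll ends a₂ {a₁} ∩ connEvent ends a₁ v) ≤
      prob p (avoidAll ends a₂ {a₁} ∩ connEvent ends a₁ v ∩ connEvent ends a₁ b) *
        prob p (avoidAll ends a₂ {a₁} ∩ ((connEvent ends a₁ v)ᶜ ∩ (connEvent ends a₂ v)ᶜ)))
    (hb₂ : prob p (avoidAll ends a₂ {a₁} ∩ connEvent ends a₂ v ∩ connEvent ends a₁ b) *
        prob p (avoidAll ends a₂ {a₁} ∩ ((connEvent ends a₁ v)ᶜ ∩ (connEvent ends a₂ v)ᶜ)) ≤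
      prob p (avoidAll ends a₂ {a₁} ∩ ((connEvent ends a₁ v)ᶜ ∩ (connEvent ends a₂ v)ᶜ) ∩
        connEvent ends a₁ b) * prob p (avoidAll ends a₂ {a₁} ∩ connEvent ends a₂ v))
    (hb₃ : prob p (avoidAll ends a₂ {a₁} ∩ connEvent ends a₁ v ∩ connEvent ends a₂ b) *
        prob p (avoidAll ends a₂ {a₁} ∩ ((connEvent ends a₁ v)ᶜ ∩ (connEvent ends a₂ v)ᶜ)) ≤
      prob p (avoidAll ends a₂ {a₁} ∩ ((connEvent ends a₁ v)ᶜ ∩ (connEvent ends a₂ v)ᶜ) ∩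
        connEvent ends a₂ b) * prob p (avoidAll ends a₂ {a₁} ∩ connEvent ends a₁ v))
    (hb₄ : prob p (avoidAll ends a₂ {a₁} ∩ ((connEvent ends a₁ v)ᶜ ∩ (connEvent ends a₂ v)ᶜ) ∩
        connEvent ends a₂ b) * prob p (avoidAll ends a₂ {a₁} ∩ connEvent ends a₂ v) ≤
      prob p (avoidAll ends a₂ {a₁} ∩ connEvent ends a₂ v ∩ connEvent ends a₂ b) *
        prob p (avoidAll ends a₂ {a₁} ∩ ((connEvent ends a₁ v)ᶜ ∩ (connEvent ends a₂ v)ᶜ)))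
    (ho₁ : prob p (avoidAll ends a₂ {a₁} ∩ ((connEvent ends a₁ v)ᶜ ∩ (connEvent ends a₂ v)ᶜ) ∩
        connEvent ends a₁ o) * prob p (avoidAll ends a₂ {a₁} ∩ connEvent ends a₁ v) ≤
      prob p (avoidAll ends a₂ {a₁} ∩ connEvent ends a₁ v ∩ connEvent ends a₁ o) *
        prob p (avoidAll ends a₂ {a₁} ∩ ((connEvent ends a₁ v)ᶜ ∩ (connEvent ends a₂ v)ᶜ)))
    (ho₂ : prob p (avoidAll ends a₂ {a₁} ∩ connEvent ends a₂ v ∩ connEvent ends a₁ o) *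
        prob p (avoidAll ends a₂ {a₁} ∩ ((connEvent ends a₁ v)ᶜ ∩ (connEvent ends a₂ v)ᶜ)) ≤
      prob p (avoidAll ends a₂ {a₁} ∩ ((connEvent ends a₁ v)ᶜ ∩ (connEvent ends a₂ v)ᶜ) ∩
        connEvent ends a₁ o) * prob p (avoidAll ends a₂ {a₁} ∩ connEvent ends a₂ v))
    (ho₃ : prob p (avoidAll ends a₂ {a₁} ∩ connEvent ends a₁ v ∩ connEvent ends a₂ o) *
        prob p (avoidAll ends a₂ {a₁} ∩ ((connEvent ends a₁ v)ᶜ ∩ (connEvent ends a₂ v)ᶜ)) ≤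
      prob p (avoidAll ends a₂ {a₁} ∩ ((connEvent ends a₁ v)ᶜ ∩ (connEvent ends a₂ v)ᶜ) ∩
        connEvent ends a₂ o) * prob p (avoidAll ends a₂ {a₁} ∩ connEvent ends a₁ v))
    (ho₄ : prob p (avoidAll ends a₂ {a₁} ∩ ((connEvent ends a₁ v)ᶜ ∩ (connEvent ends a₂ v)ᶜ) ∩
        connEvent ends a₂ o) * prob p (avoidAll ends a₂ {a₁} ∩ connEvent ends a₂ v) ≤
      prob p (avoidAll ends a₂ {a₁} ∩ connEvent ends a₂ v ∩ connEvent ends a₂ o) *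
        prob p (avoidAll ends a₂ {a₁} ∩ ((connEvent ends a₁ v)ᶜ ∩ (connEvent ends a₂ v)ᶜ))) :
    let Q := avoidAll ends a₂ {a₁}
    let SL := connEvent ends a₁ v
    let SH := connEvent ends a₂ v
    let SN := (connEvent ends a₁ v)ᶜ ∩ (connEvent ends a₂ v)ᶜ
    let Z := prob p Q
    0 ≤ fmCoarse (prob p (Q ∩ SL) / Z) (prob p (Q ∩ SH) / Z)
      (condP p Q SL (connEvent ends a₁ b)) (condP p Q SH (connEvent ends a₁ b))
      (condP p Q SN (connEvent ends a₁ b)) (condP p Q SL (connEvent ends a₂ b))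
      (condP p Q SH (connEvent ends a₂ b)) (condP p Q SN (connEvent ends a₂ b))
      (condP p Q SL (connEvent ends a₁ o)) (condP p Q SH (connEvent ends a₁ o))
      (condP p Q SN (connEvent ends a₁ o)) (condP p Q SL (connEvent ends a₂ o))
      (condP p Q SH (connEvent ends a₂ o)) (condP p Q SN (connEvent ends a₂ o)) := by
  intro Q SL SH SN Z
  have hZ : 0 < Z := lt_of_lt_of_le hL (prob_mono hp Set.inter_subset_left)
  have hsplit := CrossWeighted.status_split p ends a₁ a₂ v Set.univ
  simp only [Set.inter_univ] at hsplit
  have hN0 : 0 ≤ prob p (Q ∩ SN) := prob_nonneg hp _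
  refine fmCoarse_nonneg (div_nonneg (prob_nonneg hp _) hZ.le) (div_nonneg (prob_nonneg hp _) hZ.le)
    ?_ ?_ ?_ ?_ ?_ ?_ ?_ ?_ ?_
  · rw [← add_div, div_le_one hZ]
    linarith
  · exact condP_le_of_cleared p hN hL hb₁
  · exact condP_le_of_cleared p hH hN hb₂
  · exact condP_le_of_cleared p hL hN hb₃
  · exact condP_le_of_cleared p hN hH hb₄
  · exact condP_le_of_cleared p hN hL ho₁
  · exact condP_le_of_cleared p hH hN ho₂
  · exact condP_le_of_cleared p hL hN ho₃
  · exact condP_le_of_cleared p hN hH ho₄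

omit [Fintype E] [DecidableEq E] [Fintype V] in
/-- `{C(a₁) ∩ {a₂, v} = ∅} = Q ∩ {v ∉ C₁}` (with `Q = {a₂ ↮ a₁}`). -/
lemma avoidAll_a₁_pair_eq (ends : E → Sym2 V) (a₁ a₂ v : V) :
    avoidAll ends a₁ {a₂, v} = avoidAll ends a₂ {a₁} ∩ (connEvent ends a₁ v)ᶜ := by
  ext ω
  simp only [avoidAll, Set.mem_setOf_eq, Finset.mem_insert, Finset.mem_singleton, forall_eq_or_imp,
    forall_eq, Set.mem_inter_iff, Set.mem_compl_iff, mem_connEvent]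
  constructor
  · rintro ⟨h2, hv⟩; exact ⟨fun h => h2 (conn_symm h), hv⟩
  · rintro ⟨h2, hv⟩; exact ⟨fun h => h2 (conn_symm h), hv⟩

omit [Fintype E] [DecidableEq E] [Fintype V] [DecidableEq V] in
/-- On `Q`, `v ∈ C(a₂)` excludes `v ∈ C(a₁)`. -/
lemma H_subset_Lc (ends : E → Sym2 V) (a₁ a₂ v : V) :
    avoidAll ends a₂ {a₁} ∩ connEvent ends a₂ v ⊆ (connEvent ends a₁ v)ᶜ := by
  intro ω hω hL
  have : ω ∈ avoidAll ends a₂ {a₁} ∩ connEvent ends a₁ v ∩ connEvent ends a₂ v := ⟨⟨hω.1, hL⟩, hω.2⟩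
  rw [CrossWeighted.disjoint_L_H] at this
  exact this

/-- **The same-cluster link of the `H`-chain**, in the `Q`-masses:
`P(Q, N_v, H_o) · P(Q, H_v) ≤ P(Q, H_v, H_o) · P(Q, N_v)`, i.e. `P(o ∈ C₂ ∣ v ∉ U) ≤ P(o ∈ C₂ ∣ v ∈ C₂)`. -/
theorem chainH_masses (p : E → R) (hp : IsProbVec p) (ends : E → Sym2 V) (o a₁ a₂ v : V) :
    prob p (avoidAll ends a₂ {a₁} ∩ ((connEvent ends a₁ v)ᶜ ∩ (connEvent ends a₂ v)ᶜ) ∩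
        connEvent ends a₂ o) * prob p (avoidAll ends a₂ {a₁} ∩ connEvent ends a₂ v) ≤
      prob p (avoidAll ends a₂ {a₁} ∩ connEvent ends a₂ v ∩ connEvent ends a₂ o) *
        prob p (avoidAll ends a₂ {a₁} ∩ ((connEvent ends a₁ v)ᶜ ∩ (connEvent ends a₂ v)ᶜ)) := by
  classical
  have h := OtherClusterAvoid.condH_chain p hp ends o a₁ a₂ v
  rw [avoidAll_a₁_pair_eq ends a₁ a₂ v] at h
  set Q := avoidAll ends a₂ {a₁}
  set Lv := connEvent ends a₁ v
  set Hv := connEvent ends a₂ v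
  set Ho := connEvent ends a₂ o
  have hHsub := H_subset_Lc ends a₁ a₂ v
  -- `Q ∩ Lvᶜ = (Q ∩ Hv) ⊔ (Q ∩ (Lvᶜ ∩ Hvᶜ))`, on the whole and under `Ho`
  have eA : prob p (Q ∩ Lvᶜ) = prob p (Q ∩ Hv) + prob p (Q ∩ (Lvᶜ ∩ Hvᶜ)) := by
    have := prob_inter_add_prob_inter_compl p (Q ∩ Lvᶜ) Hv
    have e1 : Q ∩ Lvᶜ ∩ Hv = Q ∩ Hv := by
      ext ω
      constructor
      · rintro ⟨⟨hQ, _⟩, hH⟩; exact ⟨hQ, hH⟩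
      · intro hω; exact ⟨⟨hω.1, hHsub hω⟩, hω.2⟩
    have e2 : Q ∩ Lvᶜ ∩ Hvᶜ = Q ∩ (Lvᶜ ∩ Hvᶜ) := by
      ext ω; simp only [Set.mem_inter_iff, Set.mem_compl_iff]; tauto
    rw [e1, e2] at this
    linarith
  have eHo : prob p (Q ∩ Lvᶜ ∩ Ho) = prob p (Q ∩ Hv ∩ Ho) + prob p (Q ∩ (Lvᶜ ∩ Hvᶜ) ∩ Ho) := by
    have := prob_inter_add_prob_inter_compl p (Q ∩ Lvᶜ ∩ Ho) Hv
    have e1 : Q ∩ Lvᶜ ∩ Ho ∩ Hv = Q ∩ Hv ∩ Ho := by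
      ext ω
      simp only [Set.mem_inter_iff, Set.mem_compl_iff]
      constructor
      · rintro ⟨⟨⟨hQ, _⟩, hHo⟩, hH⟩; exact ⟨⟨hQ, hH⟩, hHo⟩
      · rintro ⟨⟨hQ, hH⟩, hHo⟩; exact ⟨⟨⟨hQ, hHsub ⟨hQ, hH⟩⟩, hHo⟩, hH⟩
    have e2 : Q ∩ Lvᶜ ∩ Ho ∩ Hvᶜ = Q ∩ (Lvᶜ ∩ Hvᶜ) ∩ Ho := by
      ext ω; simp only [Set.mem_inter_iff, Set.mem_compl_iff]; tauto
    rw [e1, e2] at this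
    linarith
  have eHv : Q ∩ Lvᶜ ∩ Hv = Q ∩ Hv := by
    ext ω
    constructor
    · rintro ⟨⟨hQ, _⟩, hH⟩; exact ⟨hQ, hH⟩
    · intro hω; exact ⟨⟨hω.1, hHsub hω⟩, hω.2⟩
  have eHoHv : Q ∩ Lvᶜ ∩ Ho ∩ Hv = Q ∩ Hv ∩ Ho := by
    ext ω
    simp only [Set.mem_inter_iff, Set.mem_compl_iff]
    constructor
    · rintro ⟨⟨⟨hQ, _⟩, hHo⟩, hH⟩; exact ⟨⟨hQ, hH⟩, hHo⟩
    · rintro ⟨⟨hQ, hH⟩, hHo⟩; exact ⟨⟨⟨hQ, hHsub ⟨hQ, hH⟩⟩, hHo⟩, hH⟩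
  rw [eHo, eHv, eHoHv, eA] at h
  nlinarith [h]

omit [Fintype E] [DecidableEq E] [Fintype V] [DecidableEq V] in
/-- `avoidAll ends a₁ {a₂} = avoidAll ends a₂ {a₁}`. -/
lemma Q_swap (ends : E → Sym2 V) (a₁ a₂ : V) :
    avoidAll ends a₁ {a₂} = avoidAll ends a₂ {a₁} := by
  rw [CrossWeighted.avoidAll_singleton_eq ends a₂ a₁, CrossWeighted.avoidAll_singleton_eq ends a₁ a₂,
    CrossWeighted.compl_connEvent_comm ends a₂ a₁]

/-- **(FM-coarse) for percolation**: for every vertex `v` whose three status masses are positive and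
every two marks `b, o`, the status-level first-order residual is nonnegative. -/
theorem fmCoarse_nonneg_perc (p : E → R) (hp : IsProbVec p) (ends : E → Sym2 V) (o a₁ a₂ b v : V)
    (hL : 0 < prob p (avoidAll ends a₂ {a₁} ∩ connEvent ends a₁ v))
    (hH : 0 < prob p (avoidAll ends a₂ {a₁} ∩ connEvent ends a₂ v))
    (hN : 0 < prob p (avoidAll ends a₂ {a₁} ∩ ((connEvent ends a₁ v)ᶜ ∩ (connEvent ends a₂ v)ᶜ))) :
    let Q := avoidAll ends a₂ {a₁}
    let SL := connEvent ends a₁ v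
    let SH := connEvent ends a₂ v
    let SN := (connEvent ends a₁ v)ᶜ ∩ (connEvent ends a₂ v)ᶜ
    let Z := prob p Q
    0 ≤ fmCoarse (prob p (Q ∩ SL) / Z) (prob p (Q ∩ SH) / Z)
      (condP p Q SL (connEvent ends a₁ b)) (condP p Q SH (connEvent ends a₁ b))
      (condP p Q SN (connEvent ends a₁ b)) (condP p Q SL (connEvent ends a₂ b))
      (condP p Q SH (connEvent ends a₂ b)) (condP p Q SN (connEvent ends a₂ b))
      (condP p Q SL (connEvent ends a₁ o)) (condP p Q SH (connEvent ends a₁ o))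
      (condP p Q SN (connEvent ends a₁ o)) (condP p Q SL (connEvent ends a₂ o))
      (condP p Q SH (connEvent ends a₂ o)) (condP p Q SN (connEvent ends a₂ o)) := by
  classical
  -- the swapped-root forms, read back into `Q`
  have eN : (connEvent ends a₂ v)ᶜ ∩ (connEvent ends a₁ v)ᶜ =
      (connEvent ends a₁ v)ᶜ ∩ (connEvent ends a₂ v)ᶜ := Set.inter_comm _ _
  have hb₂ := CrossWeighted.cond_cross_avoid p hp ends b a₂ a₁ v
  rw [Q_swap, eN] at hb₂
  have hb₃ := CrossWeighted.cond_cross_avoid p hp ends b a₁ a₂ v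
  have ho₂ := CrossWeighted.cond_cross_avoid p hp ends o a₂ a₁ v
  rw [Q_swap, eN] at ho₂
  have ho₃ := CrossWeighted.cond_cross_avoid p hp ends o a₁ a₂ v
  have hb₄ := chainH_masses p hp ends b a₁ a₂ v
  have ho₄ := chainH_masses p hp ends o a₁ a₂ v
  have hb₁ := chainH_masses p hp ends b a₂ a₁ v
  rw [Q_swap, eN] at hb₁
  have ho₁ := chainH_masses p hp ends o a₂ a₁ v
  rw [Q_swap, eN] at ho₁
  exact fmCoarse_nonneg_of_chains p hp ends o a₁ a₂ b v hL hH hN hb₁ hb₂ hb₃ hb₄ ho₁ ho₂ ho₃ ho₄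

end Percolation

end FMCoarse

end Summit.Ventures.PercRepro2
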